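import Summits.Ventures.Crystal3D.Bulk.RadiusTwoBarlowHolds
import Summits.Ventures.Crystal3D.Bulk.BulkOfTammes
import Summits.Ventures.Crystal3D.Bulk.BulkOfGap125
import Summits.Ventures.Crystal3D.Bulk.BulkConstant130
import HarnessLib

/-!
# Positional order (W-2P) on each route at W-1's constant of record `K = 130` — closed terms

HONEST FRAMING. Part of the venture `Summits/Ventures/Crystal3D` (cell `pub-crystal3d`, phase 2). PURE
BOOKKEEPING, the `K = 130` companion of `Bulk/PositionalOrderRoutes.lean` (filed separately only because
`Bulk/BulkConstant130.lean` was not yet built on the farm when the `702` file landed): with the radius-2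
lemma proved (`radiusTwoBarlow_holds`, `Bulk/RadiusTwoBarlowHolds.lean`, standard axioms) the positional
corollary `positionalOrder_of_bulk'` composes with each route to `BulkCrystallization3D 130` that the tree
holds (`Bulk/BulkConstant130.lean`, the fcc all-`N` staircase bound `6N − 10·N^{2/3} ≤ C(N)`), giving W-2P at
`157 · 130 · N^{2/3} = 20,410 · N^{2/3}`. Each closed term carries EXACTLY the hypothesis and the axiom grade
of its route: rows 1–4 are at COMPUTATIONAL grade through `kissingClassification_two_mul_hales_h0_holds`
(Hales 2012's kissing-configuration search: the 128 `native_decide` facts `KissingSearch.checkPart_eq_true_000…127`,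
«K12»), row 5 through `gapTupleDiam_125` (the W0625 cap cover: 67 `native_decide` facts, NO K12 fact — there the
classification side is the hypothesis), and row 6 `positionalOrder130_of_hales` is on the STANDARD axioms
(0 natives; its two Literature facts are the only hypotheses). Nothing is discharged here and no number of the
DECISION moves. GAP(1.26) itself is NOT claimed.

* `positionalOrder130_of_twelveNeighbourGap` — GAP(1.26), twelve-neighbour form ⇒ W-2P with `157 · 130`
  (computational grade: 128 K12 natives).
* `positionalOrder130_of_flyspeck_L12` — Hales's `flyspeck_L12` (HOL-Light named fact) ⇒ the same (128 K12 natives).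
* `positionalOrder130_of_tammes13` — Musin–Tarasov's Tammes(13) (named fact) ⇒ the same (128 K12 natives).
* `positionalOrder130_of_noHole_063` — the angular currency `NoHole 0.63` ⇒ the same (128 K12 natives).
* `positionalOrder130_of_kissingClassification_250` — the `h = 5/4` K-path: BIMODAL(1.25) =
  `KissingClassification (5/2)` ⇒ the same (computational grade: exactly the 67 W0625 cover natives of
  `gapTupleDiam_125`; no K12 native).
* `positionalOrder130_of_hales` — Hales's in-print route (`flyspeck_L12` + `Hales2012_kissingConfigCongruent`),
  standard axioms, 0 natives. Terms = theory-1 (g12)'s G130 sketch (HOME/phase2/theory1/glue/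
  G130_sketchB_t1g12.lean) with the tree's `positionalOrder_of_bulk'`.
-/

noncomputable section

namespace Summit.Ventures.Crystal3D

open Literature.Geometry.DiscreteGeometry

variable {N : ℕ}

/-- **W-2P at `157 · 130` from GAP(1.26)** (twelve-neighbour form at `h₀ = 1.26`). -/
theorem positionalOrder130_of_twelveNeighbourGap (h : TwelveNeighbourGap hales_h0)
    (x : Fin N → EuclideanSpace ℝ (Fin 3)) (hx : IsStickyGroundState x) :
    ((nonBarlowCentre x).card : ℝ) ≤ 157 * 130 * (N : ℝ) ^ ((2 : ℝ) / 3) :=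
  positionalOrder_of_bulk' (bulkCrystallization3D_130_of_twelveNeighbourGap h) x hx

/-- **W-2P at `157 · 130` from Hales's Lemma `L12`** (`flyspeck_L12`). -/
theorem positionalOrder130_of_flyspeck_L12 (hL12 : flyspeck_L12)
    (x : Fin N → EuclideanSpace ℝ (Fin 3)) (hx : IsStickyGroundState x) :
    ((nonBarlowCentre x).card : ℝ) ≤ 157 * 130 * (N : ℝ) ^ ((2 : ℝ) / 3) :=
  positionalOrder_of_bulk' (bulkCrystallization3D_130_of_flyspeck_L12 hL12) x hx

/-- **W-2P at `157 · 130` from Tammes(13)** (Musin–Tarasov 2012, named fact). -/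
theorem positionalOrder130_of_tammes13 (hMT : musinTarasov2012_tammes_thirteen)
    (x : Fin N → EuclideanSpace ℝ (Fin 3)) (hx : IsStickyGroundState x) :
    ((nonBarlowCentre x).card : ℝ) ≤ 157 * 130 * (N : ℝ) ^ ((2 : ℝ) / 3) :=
  positionalOrder_of_bulk'
    (bulkCrystallization3D_130_of_twelveNeighbourGap
      (TammesBridge.twelveNeighbourGap_hales_h0_of_tammes13 hMT)) x hx

/-- **W-2P at `157 · 130` from the angular cut `NoHole 0.63`** (the census's currency). -/
theorem positionalOrder130_of_noHole_063 (hAG : NoHole 0.63)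
    (x : Fin N → EuclideanSpace ℝ (Fin 3)) (hx : IsStickyGroundState x) :
    ((nonBarlowCentre x).card : ℝ) ≤ 157 * 130 * (N : ℝ) ^ ((2 : ℝ) / 3) :=
  positionalOrder_of_bulk'
    (bulkCrystallization3D_130_of_gapTupleDiam_hales_h0 (by
      rw [hales_h0_eq]
      exact gapTupleDiam_of_noHole (h := 1.26) (by rw [show (1.26 : ℝ) / 2 = 0.63 by norm_num]; exact hAG)))
    x hx

/-- **W-2P at `157 · 130` on the `h = 5/4` K-path**: BIMODAL(1.25) = `KissingClassification (5/2)`. -/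
theorem positionalOrder130_of_kissingClassification_250 (hc : KissingClassification (5 / 2))
    (x : Fin N → EuclideanSpace ℝ (Fin 3)) (hx : IsStickyGroundState x) :
    ((nonBarlowCentre x).card : ℝ) ≤ 157 * 130 * (N : ℝ) ^ ((2 : ℝ) / 3) :=
  positionalOrder_of_bulk' (bulkCrystallization3D_130_of_kissingClassification_250 hc) x hx

/-- **W-2P at `157 · 130` on Hales's in-print route, standard axioms** (the `130` twin of
`positionalOrder_of_hales`): from `flyspeck_L12` and `Hales2012_kissingConfigCongruent`. -/
theorem positionalOrder130_of_hales (hL12 : flyspeck_L12) (hcl : Hales2012_kissingConfigCongruent)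
    (x : Fin N → EuclideanSpace ℝ (Fin 3)) (hx : IsStickyGroundState x) :
    ((nonBarlowCentre x).card : ℝ) ≤ 157 * 130 * (N : ℝ) ^ ((2 : ℝ) / 3) :=
  positionalOrder_of_bulk' (bulkCrystallization3D_130_of_L12_of_kissingConfigCongruent hL12 hcl) x hx

end Summit.Ventures.Crystal3D
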